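import Literature.NumberTheory.Transcendental.HyperlogarithmsAtOne
import HarnessLib

/-!
# Hyperlogarithms on `(0,1)`, V: the duality `s ↦ 1 - s` for the alphabet `{0,1}`

Fifth layer of the analytic road to `GenusZeroPeriodsMZV`: the behaviour of the (fully regularised,
positive) multiple polylogarithms `L(b) = hlogSeries boolLetters false b` of the alphabet
`{0 ↦ false, 1 ↦ true}` under the reflection `b = 1 - s`. Everything is PROVED; no named fact.

**Theorem** (`hlogSeries_one_sub`, `hlogSeries_one_sub_eq_sum`). For `s ∈ (0,1)` and every word `W`,

  `L(1-s)_W = Σ_{W = UV} (-1)^{|U|} L'(s)_U · Z(reg V)`,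

where `L' = hlogSeries boolLetters' true` are the hyperlogarithms of the swapped alphabet
`{1 ↦ false, 0 ↦ true}` and `Z(reg V) = MZV.zetaWordSum (MZV.shuffleReg V)` are the
shuffle-regularised multiple zeta values (`Hyperlog.genAssoc_boolLetters`). In series form
`L(1-s) = θ(L'(s)) · Z` with `θ` the sign twist `(-1)^{|W|}` (`Hyperlog.sgnTwist`) and `Z` the
generalised associator of `{0,1}` (`Hyperlog.boolAssoc`): the real-variable form of Drinfeld's
relation `G₁(z) = G₀(z) Φ_KZ` between the two normalised fundamental solutions of the KZ equation
[Drinfeld1991, §2; Furusho2003, §3.1], i.e. of "the regularised value of `L(z)` at `1` is Drinfeld's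
associator" [Brown 2009, §5.5]. It gives the complete asymptotic expansion of `L(b)` at `b → 1⁻`
from the expansions at `0⁺` of `HyperlogarithmsRegularised.lean`/`HyperlogarithmsPowerSeries.lean`
applied to `L'`, which is what the evaluation of convergent integrals `∫_0^1` of polylogarithmic
integrands by regularised boundary values requires.

**Proof.** Both sides solve the triangular system `∂_s X_{cW} = -X_W/|1-s-σ_c|` on `(0,1)`
(`hasDerivAt_lhs`, from the differential equation (5.2) for all words of
`HyperlogarithmsRegularised.lean` and the chain rule; `hasDerivAt_dualRHS`, the same for `L'` with
`1/|s - σ'_c| = 1/|(1-s) - σ_c|`), hence by induction on `W` they differ by a constant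
(`lhs_sub_dualRHS_const`, mean value inequality); the constant vanishes because the difference tends
to `0` as `s → 0⁺` (`tendsto_lhs_sub_dualRHS`): writing `L(1-s) = A·R·E` by the two-sided
factorisation at `b = 1-s` (`hlogSeries_factorisation`: `A = exp(-log s · true)`,
`R = ⟨L(1-s), reg ·⟩ → Z` at rate `O(|log s|^N s)` by `hlogAt1_sub_le`, `E = exp(log(1-s) · false)`)
and `θ(L'(s)) Z = θ(f₀'(s)) · A · Z` with `f₀'(s) → 1` at rate `O(s)`, one has
`L(1-s) - θ(L'(s))Z = A((R-Z)E + Z(E-1)) + (1-θf₀')(AZ)`, a sum of products of a SMALL family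
(`O(|log s|^N s)` coefficientwise) with LOG-BOUNDED ones (`O(|log s|^N)`), which is small — a little
asymptotic calculus for families of non-commutative series near `0⁺` (`IsSmall`, `IsLogBdd`).

## References

* F. C. S. Brown, *Multiple zeta values and periods of moduli spaces `𝔐̄_{0,n}`*, Ann. Sci. Éc.
  Norm. Supér. (4) 42 (2009), 371–489, §5.5 (p. 444). doi:10.24033/asens.2099. [BrownENS2009]
* V. G. Drinfel'd, *On quasitriangular quasi-Hopf algebras and on a group that is closely connected
  with Gal(Q̄/Q)*, Leningrad Math. J. 2 (1991), §2 (`G₀`, `G₁`, `Φ_KZ`). [Drinfeld1991]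
* H. Furusho, *The multiple zeta value algebra and the stable derivation algebra*, Publ. RIMS 39
  (2003), §3.1–3.2. [Furusho2003]
-/

noncomputable section

open MeasureTheory intervalIntegral Set Filter
open scoped BigOperators Topology

namespace Literature.NumberTheory.Transcendental

namespace Hyperlog

variable {α : Type*} (σ : α → ℝ)

/-! ### Asymptotic calculus for families of series near `0⁺` -/

section AsymptoticCalculus

variable {β : Type*}

/-- A family of series is *logarithmically bounded* at `0⁺`: every coefficient is
`O((|log s|+1)^N)`. [folklore] -/
def IsLogBdd (X : ℝ → NCSeries β ℝ) : Prop :=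
  ∀ U : List β, ∃ (C : ℝ) (N : ℕ), ∀ᶠ s in 𝓝[>] (0 : ℝ), |X s U| ≤ C * (|Real.log s| + 1) ^ N

/-- A family of series is *small* at `0⁺`: every coefficient is `O((|log s|+1)^N s)`. [folklore] -/
def IsSmall (X : ℝ → NCSeries β ℝ) : Prop :=
  ∀ U : List β, ∃ (C : ℝ) (N : ℕ), ∀ᶠ s in 𝓝[>] (0 : ℝ), |X s U| ≤ C * ((|Real.log s| + 1) ^ N * s)

omit σ in
/-- Small families tend to `0` coefficientwise. [folklore] -/
theorem IsSmall.tendsto {X : ℝ → NCSeries β ℝ} (hX : IsSmall X) (U : List β) :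
    Tendsto (fun s => X s U) (𝓝[>] 0) (𝓝 0) := by
  obtain ⟨C, N, h⟩ := hX U
  refine squeeze_zero_norm' (by simpa only [Real.norm_eq_abs] using h) ?_
  simpa using (tendsto_pow_log_mul_self 1 N).const_mul C

omit σ in
/-- Small families are logarithmically bounded. [folklore] -/
theorem IsSmall.isLogBdd {X : ℝ → NCSeries β ℝ} (hX : IsSmall X) : IsLogBdd X := by
  intro U
  obtain ⟨C, N, h⟩ := hX U
  refine ⟨|C|, N, ?_⟩
  filter_upwards [h, Ioo_mem_nhdsGT (zero_lt_one' ℝ)] with s hs hs1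
  refine hs.trans ?_
  have hP : 0 ≤ (|Real.log s| + 1) ^ N := by positivity
  calc C * ((|Real.log s| + 1) ^ N * s) ≤ |C| * ((|Real.log s| + 1) ^ N * s) :=
        mul_le_mul_of_nonneg_right (le_abs_self C) (by have := hs1.1.le; positivity)
    _ ≤ |C| * ((|Real.log s| + 1) ^ N * 1) := by
        refine mul_le_mul_of_nonneg_left (mul_le_mul_of_nonneg_left hs1.2.le hP) (abs_nonneg C)
    _ = |C| * (|Real.log s| + 1) ^ N := by rw [mul_one]

omit σ in
/-- Constant families are logarithmically bounded. [folklore] -/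
theorem isLogBdd_const (Z : NCSeries β ℝ) : IsLogBdd (fun _ => Z) := fun U =>
  ⟨|Z U|, 0, Eventually.of_forall fun s => by simp⟩

omit σ in
/-- Products of logarithmically bounded families are logarithmically bounded. [folklore] -/
theorem IsLogBdd.mul {X Y : ℝ → NCSeries β ℝ} (hX : IsLogBdd X) (hY : IsLogBdd Y) :
    IsLogBdd fun s => X s * Y s := by
  classical
  intro U
  choose CX NX hCX using hX
  choose CY NY hCY using hY
  refine ⟨∑ p ∈ NCSeries.splits U, |CX p.1| * |CY p.2|, (NCSeries.splits U).sup fun p => NX p.1 + NY p.2, ?_⟩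
  have hall : ∀ᶠ s in 𝓝[>] (0 : ℝ), ∀ p ∈ NCSeries.splits U,
      |X s p.1| ≤ CX p.1 * (|Real.log s| + 1) ^ NX p.1 ∧ |Y s p.2| ≤ CY p.2 * (|Real.log s| + 1) ^ NY p.2 := by
    have h1 : ∀ᶠ s in 𝓝[>] (0 : ℝ), ∀ p ∈ NCSeries.splits U, |X s p.1| ≤ CX p.1 * (|Real.log s| + 1) ^ NX p.1 :=
      (Finset.eventually_all _).2 fun p _ => hCX p.1
    have h2 : ∀ᶠ s in 𝓝[>] (0 : ℝ), ∀ p ∈ NCSeries.splits U, |Y s p.2| ≤ CY p.2 * (|Real.log s| + 1) ^ NY p.2 :=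
      (Finset.eventually_all _).2 fun p _ => hCY p.2
    filter_upwards [h1, h2] with s h1 h2
    exact fun p hp => ⟨h1 p hp, h2 p hp⟩
  filter_upwards [hall] with s hs
  rw [NCSeries.mul_apply, Finset.sum_mul]
  refine (Finset.abs_sum_le_sum_abs _ _).trans (Finset.sum_le_sum fun p hp => ?_)
  obtain ⟨h1, h2⟩ := hs p hp
  have hL : 1 ≤ |Real.log s| + 1 := by linarith [abs_nonneg (Real.log s)]
  rw [abs_mul]
  calc |X s p.1| * |Y s p.2|
      ≤ (|CX p.1| * (|Real.log s| + 1) ^ NX p.1) * (|CY p.2| * (|Real.log s| + 1) ^ NY p.2) := by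
        refine mul_le_mul (h1.trans ?_) (h2.trans ?_) (abs_nonneg _) (by positivity)
        · exact mul_le_mul_of_nonneg_right (le_abs_self _) (by positivity)
        · exact mul_le_mul_of_nonneg_right (le_abs_self _) (by positivity)
    _ = |CX p.1| * |CY p.2| * (|Real.log s| + 1) ^ (NX p.1 + NY p.2) := by rw [pow_add]; ring
    _ ≤ |CX p.1| * |CY p.2| * (|Real.log s| + 1) ^ ((NCSeries.splits U).sup fun p => NX p.1 + NY p.2) := by
        refine mul_le_mul_of_nonneg_left (pow_le_pow_right₀ hL ?_) (by positivity)
        exact Finset.le_sup (f := fun p => NX p.1 + NY p.2) hp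

omit σ in
/-- Small times logarithmically bounded is small. [folklore] -/
theorem IsSmall.mul_isLogBdd {X Y : ℝ → NCSeries β ℝ} (hX : IsSmall X) (hY : IsLogBdd Y) :
    IsSmall fun s => X s * Y s := by
  classical
  intro U
  choose CX NX hCX using hX
  choose CY NY hCY using hY
  refine ⟨∑ p ∈ NCSeries.splits U, |CX p.1| * |CY p.2|, (NCSeries.splits U).sup fun p => NX p.1 + NY p.2, ?_⟩
  have h1 : ∀ᶠ s in 𝓝[>] (0 : ℝ), ∀ p ∈ NCSeries.splits U,
      |X s p.1| ≤ CX p.1 * ((|Real.log s| + 1) ^ NX p.1 * s) :=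
    (Finset.eventually_all _).2 fun p _ => hCX p.1
  have h2 : ∀ᶠ s in 𝓝[>] (0 : ℝ), ∀ p ∈ NCSeries.splits U, |Y s p.2| ≤ CY p.2 * (|Real.log s| + 1) ^ NY p.2 :=
    (Finset.eventually_all _).2 fun p _ => hCY p.2
  filter_upwards [h1, h2, self_mem_nhdsWithin] with s h1 h2 hs0
  have hs0' : 0 ≤ s := le_of_lt hs0
  rw [NCSeries.mul_apply, Finset.sum_mul]
  refine (Finset.abs_sum_le_sum_abs _ _).trans (Finset.sum_le_sum fun p hp => ?_)
  have hL : 1 ≤ |Real.log s| + 1 := by linarith [abs_nonneg (Real.log s)]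
  rw [abs_mul]
  calc |X s p.1| * |Y s p.2|
      ≤ (|CX p.1| * ((|Real.log s| + 1) ^ NX p.1 * s)) * (|CY p.2| * (|Real.log s| + 1) ^ NY p.2) := by
        refine mul_le_mul ((h1 p hp).trans ?_) ((h2 p hp).trans ?_) (abs_nonneg _) (by positivity)
        · exact mul_le_mul_of_nonneg_right (le_abs_self _) (by positivity)
        · exact mul_le_mul_of_nonneg_right (le_abs_self _) (by positivity)
    _ = |CX p.1| * |CY p.2| * ((|Real.log s| + 1) ^ (NX p.1 + NY p.2) * s) := by rw [pow_add]; ring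
    _ ≤ |CX p.1| * |CY p.2| *
          ((|Real.log s| + 1) ^ ((NCSeries.splits U).sup fun p => NX p.1 + NY p.2) * s) := by
        refine mul_le_mul_of_nonneg_left (mul_le_mul_of_nonneg_right (pow_le_pow_right₀ hL ?_) hs0')
          (by positivity)
        exact Finset.le_sup (f := fun p => NX p.1 + NY p.2) hp

omit σ in
/-- Logarithmically bounded times small is small. [folklore] -/
theorem IsLogBdd.mul_isSmall {X Y : ℝ → NCSeries β ℝ} (hX : IsLogBdd X) (hY : IsSmall Y) :
    IsSmall fun s => X s * Y s := by
  classical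
  intro U
  choose CX NX hCX using hX
  choose CY NY hCY using hY
  refine ⟨∑ p ∈ NCSeries.splits U, |CX p.1| * |CY p.2|, (NCSeries.splits U).sup fun p => NX p.1 + NY p.2, ?_⟩
  have h1 : ∀ᶠ s in 𝓝[>] (0 : ℝ), ∀ p ∈ NCSeries.splits U, |X s p.1| ≤ CX p.1 * (|Real.log s| + 1) ^ NX p.1 :=
    (Finset.eventually_all _).2 fun p _ => hCX p.1
  have h2 : ∀ᶠ s in 𝓝[>] (0 : ℝ), ∀ p ∈ NCSeries.splits U,
      |Y s p.2| ≤ CY p.2 * ((|Real.log s| + 1) ^ NY p.2 * s) :=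
    (Finset.eventually_all _).2 fun p _ => hCY p.2
  filter_upwards [h1, h2, self_mem_nhdsWithin] with s h1 h2 hs0
  have hs0' : 0 ≤ s := le_of_lt hs0
  rw [NCSeries.mul_apply, Finset.sum_mul]
  refine (Finset.abs_sum_le_sum_abs _ _).trans (Finset.sum_le_sum fun p hp => ?_)
  have hL : 1 ≤ |Real.log s| + 1 := by linarith [abs_nonneg (Real.log s)]
  rw [abs_mul]
  calc |X s p.1| * |Y s p.2|
      ≤ (|CX p.1| * (|Real.log s| + 1) ^ NX p.1) * (|CY p.2| * ((|Real.log s| + 1) ^ NY p.2 * s)) := by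
        refine mul_le_mul ((h1 p hp).trans ?_) ((h2 p hp).trans ?_) (abs_nonneg _) (by positivity)
        · exact mul_le_mul_of_nonneg_right (le_abs_self _) (by positivity)
        · exact mul_le_mul_of_nonneg_right (le_abs_self _) (by positivity)
    _ = |CX p.1| * |CY p.2| * ((|Real.log s| + 1) ^ (NX p.1 + NY p.2) * s) := by rw [pow_add]; ring
    _ ≤ |CX p.1| * |CY p.2| *
          ((|Real.log s| + 1) ^ ((NCSeries.splits U).sup fun p => NX p.1 + NY p.2) * s) := by
        refine mul_le_mul_of_nonneg_left (mul_le_mul_of_nonneg_right (pow_le_pow_right₀ hL ?_) hs0')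
          (by positivity)
        exact Finset.le_sup (f := fun p => NX p.1 + NY p.2) hp

omit σ in
/-- Sums of small families are small. [folklore] -/
theorem IsSmall.add {X Y : ℝ → NCSeries β ℝ} (hX : IsSmall X) (hY : IsSmall Y) :
    IsSmall fun s => X s + Y s := by
  intro U
  obtain ⟨C, N, hC⟩ := hX U
  obtain ⟨C', N', hC'⟩ := hY U
  refine ⟨|C| + |C'|, max N N', ?_⟩
  filter_upwards [hC, hC', self_mem_nhdsWithin] with s h h' hs0
  have hs0' : 0 ≤ s := le_of_lt hs0
  have hL : 1 ≤ |Real.log s| + 1 := by linarith [abs_nonneg (Real.log s)]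
  have hP : ∀ n : ℕ, n ≤ max N N' → (|Real.log s| + 1) ^ n * s ≤ (|Real.log s| + 1) ^ max N N' * s :=
    fun n hn => mul_le_mul_of_nonneg_right (pow_le_pow_right₀ hL hn) hs0'
  show |X s U + Y s U| ≤ _
  calc |X s U + Y s U| ≤ |X s U| + |Y s U| := abs_add_le _ _
    _ ≤ |C| * ((|Real.log s| + 1) ^ max N N' * s) + |C'| * ((|Real.log s| + 1) ^ max N N' * s) := by
        refine add_le_add (h.trans ?_) (h'.trans ?_)
        · exact (mul_le_mul_of_nonneg_right (le_abs_self C) (by positivity)).trans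
            (mul_le_mul_of_nonneg_left (hP N (le_max_left _ _)) (abs_nonneg C))
        · exact (mul_le_mul_of_nonneg_right (le_abs_self C') (by positivity)).trans
            (mul_le_mul_of_nonneg_left (hP N' (le_max_right _ _)) (abs_nonneg C'))
    _ = (|C| + |C'|) * ((|Real.log s| + 1) ^ max N N' * s) := by ring

omit σ in
/-- Exponentials of a letter with logarithmic exponent are logarithmically bounded:
`|exp(ℓ(s) c)_U| ≤ (|log s|+1)^{|U|}` when `|ℓ(s)| ≤ |log s| + 1`. [folklore] -/
theorem isLogBdd_expLetter [DecidableEq β] (c : β) {ℓ : ℝ → ℝ}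
    (hℓ : ∀ᶠ s in 𝓝[>] (0 : ℝ), |ℓ s| ≤ |Real.log s| + 1) :
    IsLogBdd fun s => Shuffle.expLetter c (ℓ s) := by
  intro U
  refine ⟨1, U.length, ?_⟩
  filter_upwards [hℓ] with s hs
  unfold Shuffle.expLetter
  split_ifs with h
  · rw [abs_mul, abs_pow, one_mul]
    have hf1 : (1 : ℝ) ≤ U.length.factorial := by
      exact_mod_cast Nat.one_le_iff_ne_zero.mpr (Nat.factorial_ne_zero _)
    have hfac : |algebraMap ℚ ℝ (1 / (U.length.factorial : ℚ))| ≤ 1 := by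
      rw [eq_ratCast, Rat.cast_div, Rat.cast_one, Rat.cast_natCast, abs_of_nonneg (by positivity)]
      exact div_le_one_of_le₀ hf1 (by positivity)
    calc |algebraMap ℚ ℝ (1 / (U.length.factorial : ℚ))| * |ℓ s| ^ U.length
        ≤ 1 * (|Real.log s| + 1) ^ U.length :=
          mul_le_mul hfac (pow_le_pow_left₀ (abs_nonneg _) hs _) (by positivity) zero_le_one
      _ = _ := one_mul _
  · rw [abs_zero, one_mul]; positivity

end AsymptoticCalculus

/-! ### The reflection `s ↦ 1 - s` on the alphabet `{0,1}`: `L(1-s) = θ(L'(s)) · Z` -/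

section Duality

/-- The reflected alphabet `{1,0}`: `false ↦ 1`, `true ↦ 0` (`= 1 - boolLetters`). [folklore] -/
def boolLetters' : Bool → ℝ := fun c => if c then 0 else 1

/-- `boolLetters'` has its letter at `0` at `true`, the other at `1`. [folklore] -/
theorem boolLetters'_true : boolLetters' true = 0 := rfl

/-- The admissibility of `boolLetters'` relative to the zero letter `true`. [folklore] -/
theorem boolLetters'_adm' : ∀ c, c ≠ true → 1 ≤ boolLetters' c := by
  intro c hc; cases c <;> simp_all [boolLetters']

/-- The admissibility of `boolLetters` relative to the zero letter `false`. [folklore] -/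
theorem boolLetters_adm' : ∀ c, c ≠ false → 1 ≤ boolLetters c := by
  intro c hc; cases c <;> simp_all [boolLetters]

/-- `boolLetters true = 1` and no other letter is at `1`. [folklore] -/
theorem boolLetters_one : boolLetters true = 1 ∧ ∀ c, c ≠ true → boolLetters c ≠ 1 := by
  refine ⟨rfl, fun c hc => ?_⟩; cases c <;> simp_all [boolLetters]

/-- **The reflected densities**: `1/|s - σ'_c| = 1/|(1-s) - σ_c|`. [folklore] -/
theorem pden_boolLetters' (c : Bool) (s : ℝ) : pden boolLetters' c s = pden boolLetters c (1 - s) := by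
  cases c
  · show 1 / |s - 1| = 1 / |1 - s - 0|
    rw [sub_zero, abs_sub_comm]
  · show 1 / |s - 0| = 1 / |1 - s - 1|
    rw [sub_zero, sub_sub_cancel_left, abs_neg]

/-- The sign twist `θ(X)_W = (-1)^{|W|} X_W`, an algebra automorphism of series. [folklore] -/
def sgnTwist {β : Type*} (X : NCSeries β ℝ) : NCSeries β ℝ := fun W => (-1) ^ W.length * X W

/-- `θ` is multiplicative. [folklore] -/
theorem sgnTwist_mul {β : Type*} [DecidableEq β] (X Y : NCSeries β ℝ) :
    sgnTwist (X * Y) = sgnTwist X * sgnTwist Y := by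
  funext W
  show (-1) ^ W.length * (X * Y) W = (sgnTwist X * sgnTwist Y) W
  rw [NCSeries.mul_apply, NCSeries.mul_apply, Finset.mul_sum]
  refine Finset.sum_congr rfl fun p hp => ?_
  rw [NCSeries.mem_splits] at hp
  show (-1) ^ W.length * (X p.1 * Y p.2) = ((-1) ^ p.1.length * X p.1) * ((-1) ^ p.2.length * Y p.2)
  rw [← hp, List.length_append, pow_add]; ring

/-- `θ(exp(ℓ c)) = exp(-ℓ c)`. [folklore] -/
theorem sgnTwist_expLetter {β : Type*} [DecidableEq β] (c : β) (ℓ : ℝ) :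
    sgnTwist (Shuffle.expLetter c ℓ) = Shuffle.expLetter c (-ℓ) := by
  funext W
  show (-1) ^ W.length * Shuffle.expLetter c ℓ W = Shuffle.expLetter c (-ℓ) W
  unfold Shuffle.expLetter
  split_ifs with h
  · rw [neg_pow]; ring
  · rw [mul_zero]

/-- `θ(X)_∅ = X_∅`. [folklore] -/
@[simp] theorem sgnTwist_nil {β : Type*} (X : NCSeries β ℝ) : sgnTwist X [] = X [] := by
  simp [sgnTwist]

/-- `θ(X)_{cW} = -(-1)^{|W|} X_{cW}`. [folklore] -/
theorem sgnTwist_cons {β : Type*} (X : NCSeries β ℝ) (c : β) (W : List β) :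
    sgnTwist X (c :: W) = -((-1) ^ W.length * X (c :: W)) := by
  simp only [sgnTwist, List.length_cons, pow_succ]; ring

/-- The generalised associator of `{0,1}` as a series: `Z_W = Z(reg W)`. [folklore] -/
def boolAssoc : NCSeries Bool ℝ := fun W => genAssoc boolLetters false true W

/-- `Z_W = Z(reg W) = MZV.zetaWordSum (MZV.shuffleReg W)`. [cite: BrownENS2009, §5.5] -/
theorem boolAssoc_apply (W : List Bool) : boolAssoc W = MZV.zetaWordSum (MZV.shuffleReg W) :=
  genAssoc_boolLetters W

/-- The right-hand side `θ(L'(s)) · Z` of the duality, `L' = hlogSeries boolLetters' true`. [folklore] -/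
def dualRHS (s : ℝ) : NCSeries Bool ℝ := sgnTwist (hlogSeries boolLetters' true s) * boolAssoc

/-- Coefficients of the right-hand side. [folklore] -/
theorem dualRHS_apply (s : ℝ) (W : List Bool) :
    dualRHS s W = ∑ p ∈ NCSeries.splits W,
      ((-1) ^ p.1.length * hlogSeries boolLetters' true s p.1) * boolAssoc p.2 := by
  rw [dualRHS, NCSeries.mul_apply]; rfl

/-- The ODE of the left-hand side: `∂_s L(1-s)_{cW} = -L(1-s)_W/|1-s-σ_c|`. [folklore] -/
theorem hasDerivAt_lhs (c : Bool) (W : List Bool) {s : ℝ} (hs : s ∈ Ioo (0 : ℝ) 1) :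
    HasDerivAt (fun s => hlogSeries boolLetters false (1 - s) (c :: W))
      (-(pden boolLetters c (1 - s) * hlogSeries boolLetters false (1 - s) W)) s := by
  have h1s : 1 - s ∈ Ioo (0 : ℝ) 1 := ⟨by linarith [hs.2], by linarith [hs.1]⟩
  have h := hasDerivAt_hlogSeries_cons (σ := boolLetters) rfl boolLetters_adm' c W h1s
  have h2 := h.comp s ((hasDerivAt_id s).const_sub 1)
  simpa [Function.comp_def] using h2

/-- The ODE of the right-hand side: `∂_s (θ(L'(s)) Z)_{cW} = -(θ(L'(s)) Z)_W/|1-s-σ_c|`. [folklore] -/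
theorem hasDerivAt_dualRHS (c : Bool) (W : List Bool) {s : ℝ} (hs : s ∈ Ioo (0 : ℝ) 1) :
    HasDerivAt (fun s => dualRHS s (c :: W)) (-(pden boolLetters c (1 - s) * dualRHS s W)) s := by
  classical
  have hderiv : ∀ p ∈ NCSeries.splits (c :: W),
      HasDerivAt (fun s => ((-1) ^ p.1.length * hlogSeries boolLetters' true s p.1) * boolAssoc p.2)
        ((match p.1 with
          | [] => 0
          | d :: u => (-1) ^ (u.length + 1) * (pden boolLetters' d s * hlogSeries boolLetters' true s u)) *
          boolAssoc p.2) s := by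
    intro p _
    refine HasDerivAt.mul_const ?_ _
    rcases p with ⟨u, v⟩
    cases u with
    | nil =>
      show HasDerivAt (fun s => (-1) ^ ([] : List Bool).length * hlogSeries boolLetters' true s []) 0 s
      refine (hasDerivAt_const s (1 : ℝ)).congr_of_eventuallyEq ?_
      filter_upwards [KZ3.isOpen_Ioo01.mem_nhds hs] with s' hs'
      rw [List.length_nil, pow_zero, one_mul, hlogSeries_nil (σ := boolLetters') rfl boolLetters'_adm' hs']
    | cons d u =>
      show HasDerivAt (fun s => (-1) ^ (d :: u).length * hlogSeries boolLetters' true s (d :: u))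
        ((-1) ^ (u.length + 1) * (pden boolLetters' d s * hlogSeries boolLetters' true s u)) s
      simp only [List.length_cons]
      exact (hasDerivAt_hlogSeries_cons (σ := boolLetters') rfl boolLetters'_adm' d u hs).const_mul _
  have hsum := HasDerivAt.sum hderiv
  have hsum' : HasDerivAt (fun s => dualRHS s (c :: W)) (∑ p ∈ NCSeries.splits (c :: W),
      (match p.1 with
        | [] => 0
        | d :: u => (-1) ^ (u.length + 1) * (pden boolLetters' d s * hlogSeries boolLetters' true s u)) *
        boolAssoc p.2) s := by
    refine hsum.congr_of_eventuallyEq (Eventually.of_forall fun s' => ?_)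
    show dualRHS s' (c :: W) = _
    rw [Finset.sum_apply, dualRHS_apply]
  refine hsum'.congr_deriv ?_
  rw [NCSeries.sum_splits_cons]
  simp only [zero_mul, zero_add]
  rw [dualRHS_apply, Finset.mul_sum, ← Finset.sum_neg_distrib]
  refine Finset.sum_congr rfl fun p _ => ?_
  rw [pden_boolLetters', pow_succ]
  ring

/-- **The two sides of the duality differ by a constant**: by induction on the word, the
difference `L(1-s)_W - (θ(L'(s)) Z)_W` has zero derivative on `(0,1)`. [folklore] -/
theorem lhs_sub_dualRHS_const (W : List Bool)
    (IH : ∀ s ∈ Ioo (0 : ℝ) 1, hlogSeries boolLetters false (1 - s) W = dualRHS s W) (c : Bool)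
    {s₁ s₂ : ℝ} (hs₁ : s₁ ∈ Ioo (0 : ℝ) 1) (hs₂ : s₂ ∈ Ioo (0 : ℝ) 1) :
    hlogSeries boolLetters false (1 - s₁) (c :: W) - dualRHS s₁ (c :: W) =
      hlogSeries boolLetters false (1 - s₂) (c :: W) - dualRHS s₂ (c :: W) := by
  have hD : ∀ s ∈ Ioo (0 : ℝ) 1, HasDerivWithinAt
      (fun s => hlogSeries boolLetters false (1 - s) (c :: W) - dualRHS s (c :: W)) 0 (Ioo 0 1) s := by
    intro s hs
    have h := (hasDerivAt_lhs c W hs).sub (hasDerivAt_dualRHS c W hs)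
    rw [IH s hs, sub_self] at h
    exact h.hasDerivWithinAt
  have h := Convex.norm_image_sub_le_of_norm_hasDerivWithin_le (C := 0) hD (fun s _ => by simp)
    (convex_Ioo 0 1) hs₂ hs₁
  rw [zero_mul, norm_le_zero_iff, sub_eq_zero] at h
  exact h

end Duality


/-! ### The asymptotics `s → 0⁺` of the two sides, and the duality theorem -/

section DualityProof

/-- `|log(1-s)| ≤ 2s` for `s ∈ (0, 1/2]`. [folklore] -/
theorem abs_log_one_sub_le {s : ℝ} (hs0 : 0 < s) (hs : s ≤ 1 / 2) : |Real.log (1 - s)| ≤ 2 * s := by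
  have h1 : 0 < 1 - s := by linarith
  have hle : Real.log (1 - s) ≤ 0 := Real.log_nonpos (by linarith) (by linarith)
  have hge : 1 - (1 - s)⁻¹ ≤ Real.log (1 - s) := Real.one_sub_inv_le_log_of_pos h1
  have hinv : (1 - s)⁻¹ ≤ 1 + 2 * s := by
    rw [inv_eq_one_div, div_le_iff₀ h1]; nlinarith
  rw [abs_of_nonpos hle]
  linarith

/-- The family `s ↦ exp(-log s · true)` is logarithmically bounded. [folklore] -/
theorem isLogBdd_expLetter_neg_log : IsLogBdd fun s => Shuffle.expLetter true (-Real.log s) :=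
  isLogBdd_expLetter true (Eventually.of_forall fun s => by rw [abs_neg]; linarith [abs_nonneg (Real.log s)])

/-- The family `s ↦ exp(log(1-s) · false)` is logarithmically bounded. [folklore] -/
theorem isLogBdd_expLetter_log_one_sub : IsLogBdd fun s => Shuffle.expLetter false (Real.log (1 - s)) := by
  refine isLogBdd_expLetter false ?_
  filter_upwards [Ioo_mem_nhdsGT (by norm_num : (0 : ℝ) < 1 / 2)] with s hs
  have := abs_log_one_sub_le hs.1 hs.2.le
  linarith [abs_nonneg (Real.log s), hs.2]

/-- `exp(log(1-s) · false) - 1` is small. [folklore] -/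
theorem isSmall_expLetter_log_one_sub_sub_one :
    IsSmall fun s => Shuffle.expLetter false (Real.log (1 - s)) - 1 := by
  intro v
  refine ⟨2, 0, ?_⟩
  filter_upwards [Ioo_mem_nhdsGT (by norm_num : (0 : ℝ) < 1 / 2)] with s hs
  rw [NCSeries.sub_apply, pow_zero, one_mul]
  cases v with
  | nil => rw [Shuffle.expLetter_nil, NCSeries.one_apply_nil, sub_self, abs_zero]; linarith [hs.1]
  | cons d v =>
    rw [NCSeries.one_apply_cons, sub_zero]
    unfold Shuffle.expLetter
    split_ifs with h
    · rw [abs_mul, abs_pow]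
      have hf1 : (1 : ℝ) ≤ (d :: v).length.factorial := by
        exact_mod_cast Nat.one_le_iff_ne_zero.mpr (Nat.factorial_ne_zero _)
      have hfac : |algebraMap ℚ ℝ (1 / ((d :: v).length.factorial : ℚ))| ≤ 1 := by
        rw [eq_ratCast, Rat.cast_div, Rat.cast_one, Rat.cast_natCast, abs_of_nonneg (by positivity)]
        exact div_le_one_of_le₀ hf1 (by positivity)
      have hl := abs_log_one_sub_le hs.1 hs.2.le
      have hl1 : |Real.log (1 - s)| ≤ 1 := by linarith [hs.2]
      calc |algebraMap ℚ ℝ (1 / ((d :: v).length.factorial : ℚ))| * |Real.log (1 - s)| ^ (d :: v).length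
          ≤ 1 * |Real.log (1 - s)| ^ (d :: v).length :=
            mul_le_mul_of_nonneg_right hfac (by positivity)
        _ ≤ |Real.log (1 - s)| ^ 1 := by
            rw [one_mul]; exact pow_le_pow_of_le_one (abs_nonneg _) hl1 (by simp)
        _ ≤ 2 * s := by rw [pow_one]; exact hl
    · rw [abs_zero]; linarith [hs.1]

/-- `boolLetters'` is an admissible alphabet. [folklore] -/
theorem boolLetters'_adm : ∀ c, boolLetters' c = 0 ∨ 1 ≤ boolLetters' c :=
  adm_of_zero_letter boolLetters' rfl boolLetters'_adm'

/-- `1 - θ(f₀'(s))` is small (`f₀'(s) → 1` at rate `O(s)`). [folklore] -/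
theorem isSmall_one_sub_sgnTwist_hlogReg :
    IsSmall fun s => 1 - sgnTwist (show NCSeries Bool ℝ from fun U => hlogReg boolLetters' true U s) := by
  intro U
  refine ⟨regEndNorm true U * 4 ^ U.length, 0, ?_⟩
  filter_upwards [Ioo_mem_nhdsGT (by norm_num : (0 : ℝ) < 1 / 2)] with s hs
  have hs' : s ∈ Ioo (0 : ℝ) 1 := ⟨hs.1, by linarith [hs.2]⟩
  have hC : 0 ≤ regEndNorm true U * 4 ^ U.length := by
    have := regEndNorm_nonneg (z := true) U; positivity
  rw [NCSeries.sub_apply, pow_zero, one_mul]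
  cases U with
  | nil =>
    rw [NCSeries.one_apply_nil, sgnTwist_nil]
    show |1 - hlogReg boolLetters' true [] s| ≤ _
    rw [hlogReg_nil (z := true) boolLetters'_adm hs', sub_self, abs_zero]
    exact mul_nonneg hC hs.1.le
  | cons d U =>
    rw [NCSeries.one_apply_cons, zero_sub, abs_neg, sgnTwist, abs_mul, abs_pow, abs_neg, abs_one, one_pow,
      one_mul]
    show |hlogReg boolLetters' true (d :: U) s| ≤ _
    rw [hlogReg]
    refine (Shuffle.abs_pair_le (M := 4 ^ (d :: U).length * s) fun u hu => ?_).trans (le_of_eq ?_)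
    · have hreg := isReg_of_mem_support_regEnd (σ := boolLetters') rfl boolLetters'_adm' (d :: U) hu
      have hlen := length_eq_of_mem_support_regEnd true (d :: U) hu
      have hne : u ≠ [] := by intro h; rw [h] at hlen; simp at hlen
      rw [abs_of_nonneg (hlog_nonneg boolLetters'_adm hreg hs'), ← hlen]
      refine (hlog_le_mul boolLetters'_adm hne hreg hs').trans ?_
      refine mul_le_mul_of_nonneg_right (pow_le_pow_left₀ (by have := hs'.2; positivity) ?_ _) hs.1.le
      rw [div_le_iff₀ (by linarith [hs.2])]; linarith [hs.2]
    · rw [regEndNorm]; ring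

omit σ in
/-- `topBound` decreases in the base point: `M_x ≤ M_{1/2}` for `x ≥ 1/2`. [folklore] -/
theorem topBound_le_half {γ : Type*} [Fintype γ] (τ : γ → ℝ) {x : ℝ} (hx : 1 / 2 ≤ x) :
    topBound τ x ≤ topBound τ (1 / 2) := by
  unfold topBound
  have : 2 / x ≤ 2 / (1 / 2) := div_le_div_of_nonneg_left (by norm_num) (by norm_num) hx
  linarith

/-- `⟨L(1-s), reg ·⟩ - Z` is small (the rate at the top, `hlogAt1_sub_le`). [folklore] -/
theorem isSmall_hlogReg2_sub_boolAssoc :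
    IsSmall fun s => (show NCSeries Bool ℝ from fun U => hlogReg2 boolLetters false true U (1 - s)) - boolAssoc := by
  intro U
  set T : ℝ := topBound boolLetters (1 / 2) with hT
  refine ⟨Shuffle.regNorm false true U * ((U.length + 1) * (T ^ U.length * ((U.length + 1) * 4 ^ U.length))),
    U.length, ?_⟩
  filter_upwards [Ioo_mem_nhdsGT (by norm_num : (0 : ℝ) < 1 / 2)] with s hs
  have hb : 1 - s ∈ Ioo (1 / 2 : ℝ) 1 := ⟨by linarith [hs.2], by linarith [hs.1]⟩
  have hT0 : 0 ≤ T := by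
    have := (topBound_ge boolLetters (1 / 2)).1; rw [hT]; linarith
  rw [NCSeries.sub_apply]
  show |hlogReg2 boolLetters false true U (1 - s) - genAssoc boolLetters false true U| ≤ _
  rw [hlogReg2, genAssoc, Shuffle.pair_sub]
  refine (Shuffle.abs_pair_le (M := (U.length + 1) * (T ^ U.length * ((U.length + 1) * 4 ^ U.length *
    (1 + |Real.log s|) ^ U.length)) * s) fun v hv => ?_).trans (le_of_eq ?_)
  · have hreg := isReg_of_mem_support_reg (σ := boolLetters) rfl boolLetters_adm' (by decide) U hv
    have htop := isTopReg_of_mem_support_reg (σ := boolLetters) boolLetters_one.2 U hv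
    have hlen := Shuffle.length_eq_of_mem_support_reg false true U hv
    obtain ⟨h0, h1⟩ := hlogAt1_sub_le boolLetters_adm hreg htop hb
    rw [abs_sub_comm, abs_of_nonneg h0]
    rw [sub_sub_cancel] at h1
    refine h1.trans ?_
    rw [hlen]
    have hTle : topBound boolLetters (1 - s) ≤ T := topBound_le_half boolLetters hb.1.le
    have h1s : 0 < 1 - s := by linarith [hs.2]
    have hT1 : 0 ≤ topBound boolLetters (1 - s) := by
      have := (topBound_ge boolLetters (1 - s)).1
      have h2 : (0 : ℝ) ≤ 2 / (1 - s) := by positivity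
      linarith
    have hs0 := hs.1.le
    gcongr
  · rw [Shuffle.regNorm, add_comm (1 : ℝ) |Real.log s|]; ring

/-- A family eventually equal to a small family is small. [folklore] -/
theorem IsSmall.congr {β : Type*} {X Y : ℝ → NCSeries β ℝ} (hX : IsSmall X)
    (h : ∀ᶠ s in 𝓝[>] (0 : ℝ), X s = Y s) : IsSmall Y := by
  intro U
  obtain ⟨C, N, hC⟩ := hX U
  refine ⟨C, N, ?_⟩
  filter_upwards [hC, h] with s hs hs'
  rwa [← hs']

/-- **The difference of the two sides is small**: on `(0,1)`,
`L(1-s) - θ(L'(s)) Z = A ((R - Z) E + Z (E - 1)) + (1 - θ f₀') (A Z)` with `A = exp(-log s · true)`,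
`R = ⟨L(1-s), reg ·⟩`, `E = exp(log(1-s) · false)`, `θ f₀' = θ(f₀'(s))`, every summand being
(small × log-bounded). [folklore] -/
theorem isSmall_lhs_sub_dualRHS :
    IsSmall fun s => hlogSeries boolLetters false (1 - s) - dualRHS s := by
  set A : ℝ → NCSeries Bool ℝ := fun s => Shuffle.expLetter true (-Real.log s) with hA
  set R : ℝ → NCSeries Bool ℝ := fun s =>
    (show NCSeries Bool ℝ from fun U => hlogReg2 boolLetters false true U (1 - s)) with hR
  set E : ℝ → NCSeries Bool ℝ := fun s => Shuffle.expLetter false (Real.log (1 - s)) with hE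
  set Θ : ℝ → NCSeries Bool ℝ := fun s =>
    sgnTwist (show NCSeries Bool ℝ from fun U => hlogReg boolLetters' true U s) with hΘ
  have hP : IsSmall fun s => A s * ((R s - boolAssoc) * E s + boolAssoc * (E s - 1)) +
      (1 - Θ s) * (A s * boolAssoc) := by
    refine IsSmall.add (IsLogBdd.mul_isSmall isLogBdd_expLetter_neg_log (IsSmall.add ?_ ?_)) ?_
    · exact isSmall_hlogReg2_sub_boolAssoc.mul_isLogBdd isLogBdd_expLetter_log_one_sub
    · exact (isLogBdd_const boolAssoc).mul_isSmall isSmall_expLetter_log_one_sub_sub_one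
    · exact isSmall_one_sub_sgnTwist_hlogReg.mul_isLogBdd
        (isLogBdd_expLetter_neg_log.mul (isLogBdd_const boolAssoc))
  refine hP.congr ?_
  filter_upwards [Ioo_mem_nhdsGT (zero_lt_one' ℝ)] with s hs
  have h1s : 1 - s ∈ Ioo (0 : ℝ) 1 := ⟨by linarith [hs.2], by linarith [hs.1]⟩
  -- the left-hand side, factorised at `b = 1 - s`
  have hL : hlogSeries boolLetters false (1 - s) = A s * R s * E s := by
    rw [hlogSeries_factorisation (σ := boolLetters) (z := false) (o := true) rfl boolLetters_adm' rfl
      h1s, sub_sub_cancel]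
  -- the right-hand side: `θ(f₀' exp(log s · true)) Z = θ f₀' · A · Z`
  have hRHS : dualRHS s = Θ s * A s * boolAssoc := by
    rw [dualRHS, hlogSeries, sgnTwist_mul, sgnTwist_expLetter]
  rw [hL, hRHS]
  noncomm_ring

/-- The coefficientwise limit `L(1-s)_W - (θ(L'(s)) Z)_W → 0` as `s → 0⁺`. [folklore] -/
theorem tendsto_lhs_sub_dualRHS (W : List Bool) :
    Tendsto (fun s => hlogSeries boolLetters false (1 - s) W - dualRHS s W) (𝓝[>] 0) (𝓝 0) := by
  have h := isSmall_lhs_sub_dualRHS.tendsto W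
  simpa only [NCSeries.sub_apply] using h

/-- **Duality `s ↦ 1 - s` for the hyperlogarithms of `{0,1}`** (the real form of
`Li(1-z) = θ(Li'(z)) · Φ`, Drinfeld's `G₁ = G₀ Φ_KZ`): for `s ∈ (0,1)` and every word `W`,
`L(1-s)_W = Σ_{W = UV} (-1)^{|U|} L'(s)_U · Z(reg V)`, where `L = hlogSeries boolLetters false` are the
(positive, fully regularised) multiple polylogarithms of the alphabet `0 ↦ false, 1 ↦ true`, `L'` the
same for the swapped alphabet, and `Z(reg V) = MZV.zetaWordSum (MZV.shuffleReg V)` the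
shuffle-regularised multiple zeta values. Proof: both sides solve the same triangular ODE in `s`
(`hasDerivAt_lhs`, `hasDerivAt_dualRHS`), so by induction on `W` they differ by a constant, which
vanishes because the difference tends to `0` as `s → 0⁺` (`tendsto_lhs_sub_dualRHS`: the two-sided
factorisation of `L` at `1⁻` against the regularisation of `L'` at `0⁺`).
[cite: BrownENS2009, §5.5 (Reg(L(z),1) is Drinfeld's associator)] -/
theorem hlogSeries_one_sub : ∀ (W : List Bool) {s : ℝ}, s ∈ Ioo (0 : ℝ) 1 →
    hlogSeries boolLetters false (1 - s) W = dualRHS s W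
  | [], s, hs => by
    have h1s : 1 - s ∈ Ioo (0 : ℝ) 1 := ⟨by linarith [hs.2], by linarith [hs.1]⟩
    have hsp : NCSeries.splits ([] : List Bool) = {([], [])} := by
      ext p
      simp only [NCSeries.mem_splits, Finset.mem_singleton, List.append_eq_nil_iff, Prod.ext_iff]
    rw [hlogSeries_nil (σ := boolLetters) rfl boolLetters_adm' h1s, dualRHS_apply, hsp, Finset.sum_singleton]
    simp only [List.length_nil, pow_zero, one_mul]
    rw [hlogSeries_nil (σ := boolLetters') rfl boolLetters'_adm' hs, one_mul]
    exact (genAssoc_nil (σ := boolLetters) rfl boolLetters_adm' rfl boolLetters_one.2).symm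
  | c :: W, s, hs => by
    have IH : ∀ s ∈ Ioo (0 : ℝ) 1, hlogSeries boolLetters false (1 - s) W = dualRHS s W :=
      fun s hs => hlogSeries_one_sub W hs
    have hconst : Tendsto (fun s' => hlogSeries boolLetters false (1 - s') (c :: W) - dualRHS s' (c :: W))
        (𝓝[>] 0) (𝓝 (hlogSeries boolLetters false (1 - s) (c :: W) - dualRHS s (c :: W))) := by
      refine (tendsto_const_nhds (x := hlogSeries boolLetters false (1 - s) (c :: W) - dualRHS s (c :: W))).congr' ?_
      filter_upwards [Ioo_mem_nhdsGT (zero_lt_one' ℝ)] with s' hs'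
      exact lhs_sub_dualRHS_const W IH c hs hs'
    exact sub_eq_zero.1 (tendsto_nhds_unique hconst (tendsto_lhs_sub_dualRHS (c :: W)))

/-- The duality, spelled out with the regularised multiple zeta values. [cite: BrownENS2009, §5.5] -/
theorem hlogSeries_one_sub_eq_sum (W : List Bool) {s : ℝ} (hs : s ∈ Ioo (0 : ℝ) 1) :
    hlogSeries boolLetters false (1 - s) W = ∑ p ∈ NCSeries.splits W,
      ((-1) ^ p.1.length * hlogSeries boolLetters' true s p.1) * MZV.zetaWordSum (MZV.shuffleReg p.2) := by
  rw [hlogSeries_one_sub W hs, dualRHS_apply]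
  refine Finset.sum_congr rfl fun p _ => ?_
  rw [boolAssoc_apply]

end DualityProof

end Hyperlog

end Literature.NumberTheory.Transcendental
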